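import Literature.NumberTheory.Automorphic.CongruenceSubgroupPropertySL2Away
import Literature.NumberTheory.Automorphic.CongruenceSubgroupPropertySL2Lemma1
import Literature.NumberTheory.Automorphic.CongruenceSubgroupPropertySL2Lemma5
import Literature.GroupTheory.ArithmeticGroups.ElementaryBoundedGeneration
import Mathlib.RingTheory.DedekindDomain.Dvr
import HarnessLib

/-!
# `G(A, NA) = E(A, NA)` in `SL₂(ℤ[1/m])`: the relative elementary group of level `N` from the two
# printed inputs (Morris 2007 Thm. 6.1 (2) + Serre 1970 Cor. 3) via Vaserstein's Lemma 1

Topic `Literature/NumberTheory/Automorphic`; namespace `Literature.NumberTheory.Automorphic`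
(sub-namespace `SL2Rel`).  Everything here is PROVED; no definitions, no new named facts.  The two
named facts used are DISPLAYED as hypotheses `(hL : Morris2007.thm61_2_elementary_boundedlyGenerates)`
and `(hC : SerreSL2Congruence1970_congruenceSubgroupProperty_away)` (cite-only, files
`GroupTheory/ArithmeticGroups/ElementaryBoundedGeneration.lean`, `CongruenceSubgroupPropertySL2Away.lean`).

**What is proved.**  For `A = ℤ[1/m]` (`Localization.Away (m : ℤ)`, `m ≥ 2`) and an integer `N ≥ 1`,
Vaserstein's relative groups of `CongruenceSubgroupPropertySL2Proofs.lean` at the pair `(A, NA)`: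
`G(A, NA) = relG ⊤ (N) = {(a b; c d) ∈ SL₂(A) : c ∈ NA, a ≡ d ≡ 1 (mod N)}` and
`E(A, NA) = relE ⊤ (N) = ⟨E₁₂(x), E₂₁(N y) : x, y ∈ A⟩` (the subgroup GENERATED), satisfy

  `SL2Rel.relG_top_span_le_relE_of_morris_of_serre : (hL) → (hC) → relG ⊤ (N) ≤ relE ⊤ (N)`,

hence `relG ⊤ (N) = relE ⊤ (N)` (`relE_le_relG`, tree) and `Γ(NA) ≤ E(A, NA)`.  This is the instance
`(I₁, I₂) = (A, NA)` of **Vaserstein's theorem** "`G(I₁, I₂) = E(I₁, I₂)` for a Dedekind ring of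
arithmetic type with infinitely many units and non-zero ideals `I₁, I₂`" [Vaserstein1972SL2, Theorem]
(with Bass–Milnor–Serre Thm. 3.6, `ℤ[1/m]` having a real place) — obtained here NOT from that source
but from the two printed inputs of cell bsd-f3-mu's THEOREM B (MEMO-an §13.2): (L) gives that
`E(NA, NA)` has finite index in `SL₂(A)` (`Morris2007.relE_span_natCast_finiteIndex`), (C) that it
therefore contains some `Γ(MA)`, `M ≥ 1` (`exists_Gamma_span_natCast_le`), and the tree's
**Vaserstein Lemma 1 over an arbitrary Dedekind domain** (`SL2Rel.exists_mul_relE_mem_Gamma`, file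
`…Lemma1.lean`: for `g ∈ G(I₁, I₂)` and `0 ≠ J ⊆ I₁` there is `E ∈ E(I₁, I₂)` with `gE ∈ Γ(J)`) then
gives `g = (gE)E⁻¹ ∈ E(A, NA)` — `SL2Rel.relG_top_le_relE_top_of_Gamma_le` (any Dedekind domain:
`Γ(J) ≤ E(A, I₂)` for one `J ≠ 0` forces `G(A, I₂) = E(A, I₂)`).  In cell bsd-f3-mu's notation this is
"`ker χ = Δ₁(N) = ⟨U⁺(A), U⁻(NA)⟩`": THEOREM B's steps (ii)–(iv) (finite index, level `M′`, CRT + Gauss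
decomposition modulo `M′`) collapse into this one inclusion; the remaining group-theoretic step (E)
(`Γ_H(N) ⊆ ⟨U⁺(A), U⁻(NA), diag(p, p⁻¹), −1⟩`) is one right multiplication by a diagonal unit matrix,
recorded over any commutative ring as `SL2Rel.mul_diagHom_mem_relG_top` / `mem_of_relG_top_le_of_diagHom_mem`.

Also: `isDomain_away`, `isDedekindDomain_away` (`ℤ[1/m]` is a Dedekind domain: Mathlib's
`IsLocalization.isDedekindDomain`).

References: [Vaserstein1972SL2] L. N. Vaserstein, Mat. Sb. 89 (131) (1972) 313–322, Lemma 1 and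
Theorem; [Morris2007] Thm. 6.1 (2); [SerreSL2Congruence1970] §1.1 (`h(x) = diag(x, x⁻¹)`), §1.4
Prop. 1, §2.6 Cor. 3; [BassMilnorSerre1967] Ch. I Thm. 3.6.
-/

open Matrix MatrixGroups

namespace Literature.NumberTheory.Automorphic

namespace SL2Rel

open Literature.GroupTheory.ArithmeticGroups

/-! ### Over a Dedekind domain: one principal congruence subgroup inside `E(A, I₂)` forces `G = E` -/

/-- **`Γ(J) ≤ E(A, I₂)` for some `J ≠ 0` implies `G(A, I₂) ≤ E(A, I₂)`** over a Dedekind domain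
(Vaserstein's Lemma 1 in the tree's sharp form `exists_mul_relE_mem_Gamma`: every `g ∈ G(A, I₂)` has
`gE ∈ Γ(J)` for some `E ∈ E(A, I₂)`, so `g = (gE)E⁻¹`). [cite: Vaserstein1972SL2, Lemma 1 and Theorem] -/
theorem relG_top_le_relE_top_of_Gamma_le {R : Type*} [CommRing R] [IsDedekindDomain R]
    {I₂ J : Ideal R} (hJ : J ≠ ⊥) (hΓ : Gamma J ≤ relE ⊤ I₂) : relG ⊤ I₂ ≤ relE ⊤ I₂ := by
  intro M hM
  obtain ⟨E, hE, hME⟩ := exists_mul_relE_mem_Gamma hJ le_top hM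
  have : M = M * E * E⁻¹ := by group
  rw [this]
  exact (relE ⊤ I₂).mul_mem (hΓ hME) ((relE ⊤ I₂).inv_mem hE)

/-- Under the same hypothesis, `G(A, I₂) = E(A, I₂)`. [cite: Vaserstein1972SL2, Theorem] -/
theorem relG_top_eq_relE_top_of_Gamma_le {R : Type*} [CommRing R] [IsDedekindDomain R]
    {I₂ J : Ideal R} (hJ : J ≠ ⊥) (hΓ : Gamma J ≤ relE ⊤ I₂) : relG ⊤ I₂ = relE ⊤ I₂ :=
  le_antisymm (relG_top_le_relE_top_of_Gamma_le hJ hΓ) (relE_le_relG ⊤ I₂)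

/-! ### `ℤ[1/m]` is a Dedekind domain -/

/-- `ℤ[1/m]` is a domain (`m ≠ 0`). [cite: SerreSL2Congruence1970, §1.1 (`A_S` est un anneau de Dedekind)] -/
theorem isDomain_away {m : ℕ} (hm : m ≠ 0) : IsDomain (Localization.Away (m : ℤ)) :=
  IsLocalization.isDomain_of_le_nonZeroDivisors _
    (powers_le_nonZeroDivisors_of_noZeroDivisors (by exact_mod_cast hm : (m : ℤ) ≠ 0))

/-- `ℤ[1/m]` is a Dedekind domain (`m ≠ 0`): a localisation of the Dedekind domain `ℤ`.
[cite: SerreSL2Congruence1970, §1.1 (`A_S` est un anneau de Dedekind)] -/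
theorem isDedekindDomain_away {m : ℕ} (hm : m ≠ 0) : IsDedekindDomain (Localization.Away (m : ℤ)) := by
  have hM : Submonoid.powers (m : ℤ) ≤ nonZeroDivisors ℤ :=
    powers_le_nonZeroDivisors_of_noZeroDivisors (by exact_mod_cast hm)
  haveI : IsDomain (Localization.Away (m : ℤ)) := isDomain_away hm
  exact IsLocalization.isDedekindDomain ℤ hM (Localization.Away (m : ℤ))

/-! ### `G(A, NA) = E(A, NA)` over `A = ℤ[1/m]` from (L) + (C) -/

/-- **Vaserstein's `G(A, NA) ≤ E(A, NA)` over `A = ℤ[1/m]` (`m ≥ 2`, `N ≥ 1`) from the two printed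
inputs of THEOREM B**: by (L) [Morris2007, Thm. 6.1 (2)] `E(NA, NA)` has finite index in `SL₂(A)`, by
(C) [SerreSL2Congruence1970, §2.6 Cor. 3] it contains `Γ(MA)` for some `M ≥ 1`, and
`E(NA, NA) ≤ E(A, NA)`; conclude by `relG_top_le_relE_top_of_Gamma_le`.  In words: every
`(a b; c d) ∈ SL₂(ℤ[1/m])` with `N ∣ c` and `a ≡ d ≡ 1 (mod N)` is a product of upper elementary
matrices `E₁₂(x)`, `x ∈ ℤ[1/m]`, and lower ones `E₂₁(Ny)`.
[cite: Vaserstein1972SL2, Theorem; Morris2007, Thm. 6.1 (2); SerreSL2Congruence1970, §2.6 Cor. 3] -/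
theorem relG_top_span_le_relE_of_morris_of_serre
    (hL : Morris2007.thm61_2_elementary_boundedlyGenerates)
    (hC : SerreSL2Congruence1970_congruenceSubgroupProperty_away) {m : ℕ} (hm : 2 ≤ m) {N : ℕ}
    (hN : N ≠ 0) :
    relG ⊤ (Ideal.span {(N : Localization.Away (m : ℤ))}) ≤
      relE ⊤ (Ideal.span {(N : Localization.Away (m : ℤ))}) := by
  haveI := isDedekindDomain_away (m := m) (by omega)
  have hfi := Morris2007.relE_span_natCast_finiteIndex hL hm hN
  obtain ⟨M, hM0, hΓ⟩ := exists_Gamma_span_natCast_le hC hm _ hfi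
  have hJ : Ideal.span {(M : Localization.Away (m : ℤ))} ≠ ⊥ := by
    rw [Ne, Ideal.span_singleton_eq_bot]
    exact natCast_ne_zero_away (by omega) hM0.ne'
  exact relG_top_le_relE_top_of_Gamma_le hJ (le_trans hΓ (relE_mono le_top le_rfl))

/-- Hence **`G(A, NA) = E(A, NA)`** over `ℤ[1/m]` (`m ≥ 2`, `N ≥ 1`), from (L) + (C).
[cite: Vaserstein1972SL2, Theorem; Morris2007, Thm. 6.1 (2); SerreSL2Congruence1970, §2.6 Cor. 3] -/
theorem relG_top_span_eq_relE_of_morris_of_serre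
    (hL : Morris2007.thm61_2_elementary_boundedlyGenerates)
    (hC : SerreSL2Congruence1970_congruenceSubgroupProperty_away) {m : ℕ} (hm : 2 ≤ m) {N : ℕ}
    (hN : N ≠ 0) :
    relG ⊤ (Ideal.span {(N : Localization.Away (m : ℤ))}) =
      relE ⊤ (Ideal.span {(N : Localization.Away (m : ℤ))}) :=
  le_antisymm (relG_top_span_le_relE_of_morris_of_serre hL hC hm hN) (relE_le_relG _ _)

/-- `Γ(I) ≤ G(R, I)` (the relative group with no condition on the upper right entry).
[cite: Vaserstein1972SL2, p. 313 (definition of `G(I₁, I₂)`)] -/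
theorem Gamma_le_relG_top_left {R : Type*} [CommRing R] (I : Ideal R) : Gamma I ≤ relG ⊤ I := by
  intro M hM
  rw [mem_Gamma] at hM
  rw [mem_relG, Ideal.top_mul]
  exact ⟨Submodule.mem_top, hM.2.1, hM.2.2.1, hM.2.2.2⟩

/-- In particular **`Γ(NA) ≤ E(A, NA) = ⟨E₁₂(A), E₂₁(NA)⟩`** over `ℤ[1/m]` (the containment THEOREM B's
§13.2 (iii) asks of `E(N, p) ⊇ E(A, NA)`, here with `M′ = N`), from (L) + (C).
[cite: Vaserstein1972SL2, Theorem; Morris2007, Thm. 6.1 (2); SerreSL2Congruence1970, §2.6 Cor. 3] -/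
theorem Gamma_span_le_relE_top_of_morris_of_serre
    (hL : Morris2007.thm61_2_elementary_boundedlyGenerates)
    (hC : SerreSL2Congruence1970_congruenceSubgroupProperty_away) {m : ℕ} (hm : 2 ≤ m) {N : ℕ}
    (hN : N ≠ 0) :
    Gamma (Ideal.span {(N : Localization.Away (m : ℤ))}) ≤
      relE ⊤ (Ideal.span {(N : Localization.Away (m : ℤ))}) :=
  le_trans (Gamma_le_relG_top_left _) (relG_top_span_le_relE_of_morris_of_serre hL hC hm hN)

/-! ### The diagonal step of THEOREM B's (E), over any commutative ring -/

section CommRing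

variable {R : Type*} [CommRing R]

/-- **Right multiplication by a diagonal unit matrix lands in `G(R, I)`**: if `γ = (a b; c d) ∈ SL₂(R)`
has `c ∈ I` and `d ≡ v (mod I)` for a unit `v`, then `γ · diag(v, v⁻¹) = (av, bv⁻¹; cv, dv⁻¹)` lies in
`G(R, I) = {c′ ∈ I, a′ ≡ d′ ≡ 1 (mod I)}` (`dv⁻¹ - 1 = v⁻¹(d - v)`, `av - 1 = -a(d - v) + bc` by
`ad - bc = 1`).  (Serre's `h(x) = diag(x, x⁻¹)`, §1.1; the diagonal/Gauss step (iv) of cell bsd-f3-mu's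
MEMO-an §13.2 with `v = ±pᵏ`: for `γ ∈ Γ_H(N)` this puts `γ · h(±pᵏ)` in `G(A, NA) = E(A, NA)`.)
[cite: SerreSL2Congruence1970, §1.1 (`h(x)`); Vaserstein1972SL2, p. 313] -/
theorem mul_diagHom_mem_relG_top {I : Ideal R} {γ : SL(2, R)} (v : Rˣ) (hc : γ 1 0 ∈ I)
    (hd : γ 1 1 - (v : R) ∈ I) : γ * diagHom v ∈ relG ⊤ I := by
  have hdet : γ 0 0 * γ 1 1 - γ 0 1 * γ 1 0 = 1 := by
    have h := γ.2
    rw [Matrix.det_fin_two] at h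
    exact h
  have hu : (↑v⁻¹ : R) * (v : R) = 1 := Units.inv_mul v
  rw [mem_relG, Ideal.top_mul]
  simp only [mul_apply_two, diagHom_apply_00, diagHom_apply_01, diagHom_apply_10, diagHom_apply_11,
    mul_zero, add_zero, zero_add]
  refine ⟨Submodule.mem_top, I.mul_mem_right _ hc, ?_, ?_⟩
  · have h1 : γ 0 0 * (v : R) - 1 = -(γ 0 0) * (γ 1 1 - v) + γ 0 1 * γ 1 0 := by
      linear_combination hdet
    rw [h1]
    exact I.add_mem (I.mul_mem_left _ hd) (I.mul_mem_left _ hc)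
  · have h2 : γ 1 1 * (↑v⁻¹ : R) - 1 = (↑v⁻¹ : R) * (γ 1 1 - v) := by
      linear_combination hu
    rw [h2]
    exact I.mul_mem_left _ hd

/-- Hence: if `G(R, I) ≤ H` and `diag(v, v⁻¹) ∈ H` then every `γ` with `γ₁₀ ∈ I`, `γ₁₁ ≡ v (mod I)`
lies in `H` (`γ = (γ · h(v)) · h(v)⁻¹`) — the shape of THEOREM B's (E) with
`H = ⟨E(A, NA), h(p), -1⟩`. [cite: SerreSL2Congruence1970, §1.1 (`h(x)`)] -/
theorem mem_of_relG_top_le_of_diagHom_mem {I : Ideal R} {H : Subgroup SL(2, R)} (hG : relG ⊤ I ≤ H)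
    {v : Rˣ} (hv : diagHom v ∈ H) {γ : SL(2, R)} (hc : γ 1 0 ∈ I) (hd : γ 1 1 - (v : R) ∈ I) :
    γ ∈ H := by
  have h : γ = γ * diagHom v * (diagHom v)⁻¹ := by group
  rw [h]
  exact H.mul_mem (hG (mul_diagHom_mem_relG_top v hc hd)) (H.inv_mem hv)

end CommRing

end SL2Rel

end Literature.NumberTheory.Automorphic
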